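import Literature.MathematicalPhysics.QuantumLattice.HubbardGridFieldSubstitution
import Literature.MathematicalPhysics.QuantumLattice.SectorisedKernelNorm
import Literature.MathematicalPhysics.QuantumLattice.GrassmannLinearSubstitution
import HarnessLib

/-!
# Cross-grid Young inequality: the sectorised `L¹–L^∞` norm of the image of a grid polynomial under the time-grid
# substitution, from the pinned `ℓ¹` norms of its grid kernels and the `L¹` sizes of the sector transfer functions

Topic `MathematicalPhysics/QuantumLattice`; joins `HubbardGridFieldSubstitution` (the substitution `S = hubbardGridSub L M β N`
of the position–time fields on the `N`-point time grid into the momentum-labelled algebra `HubbardGrassmann L M`) and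
`SectorisedKernelNorm` (BGM's sectorised position-space kernels `sectorisedKernel` on the `2M`-point dual time lattice
`SpaceTimeIdx L M` and their `L¹–L^∞` norm `hubbardSectorKernelNorm`, (2.70)–(2.77)).  When the ultraviolet Gaussian step is run on
the grid algebra (vertices `hubbardGridInteraction`, counterterm, determinant-bounded covariance `Sᵀ C S`; kernels bounded by
`GrassmannEffectiveActionBoundDB.sum_norm_kernel_effAction_le_of_gramBounded` in the PINNED `ℓ¹` form
`Σ_{Y : Y p = w} ‖kernel F m Y‖ ≤ K`), the effective action of the model is the image `map (toLin' S) F`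
(`GrassmannLinearSubstitution.effAction_map`), and its sectorised norms are what the multiscale analysis reads.  This file is the
transfer:

* `gridLegTransfer β Fam ℓ x Y = Φ_ℓ(x; Y) := Σ_k F_ω(k) e^{-i s_c k·x} S((k,σ,c), Y)` — the sector cutoff `F_ω` of the leg label
  `ℓ = ((ω,σ),c)`, Fourier-transformed between the dual-lattice point `x` and the grid leg `Y` (it vanishes unless `Y` carries the same
  spin and charge);
* **`sectorisedKernel_map_hubbardGridSub`** — `W_{m,Ω}(x) = Σ_Y [∏_i Φ_{Ω_i}(x_i; Y_i)] · kernel F m Y` (`kernel_map` and the product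
  of the leg sums);
* `sum_filter_prod_eq` — pinned sums of products over tuples factorise (`Fin.insertNth`);
* **`hubbardSectorKernelNorm_map_hubbardGridSub_le`** — for every multiplier family, every constraint set `A`, every degree `m + 1`:
  `‖map S F‖_{sect} ≤ B^m · D · K`, where `B` bounds the label-summed weighted `L¹` norms `Σ_ℓ ε_x Σ_x |Φ_ℓ(x; Y)|` (every grid leg `Y`),
  `D` bounds the grid sums `Σ_Y |Φ_ℓ(x; Y)|` (every `ℓ, x`), and `K` the pinned `ℓ¹` norms of the degree-`(m+1)` grid kernels of `F`
  (Young's inequality leg by leg: the `m` integrated legs cost `B` each, the pinned leg costs `D`).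

Purely combinatorial (finite sums); the analytic content — the sizes `B`, `D` of the sector transfer functions and the kernel bound
`K` — is supplied by the user.  Everything is proved; the one definition is the transfer function; no named facts.

## Sources

G. Benfatto, A. Giuliani, V. Mastropietro, Ann. Henri Poincaré 7 (2006) 809–898, §2.7 (2.70)–(2.71), §2.8 (2.76)–(2.77), (2.82)
[`BenfattoGiulianiMastropietro2006`]; M. Salmhofer, *Renormalization* (1999), §4.2.4 (4.54)–(4.58), App. B.2 (B.23)–(B.25) [`Salmhofer1999`].
-/

noncomputable section

namespace Literature.MathematicalPhysics.QuantumLattice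

open GrassmannAlgebra Finset Literature.Probability.LatticeModels

/-! ### Pinned sums of products over tuples factorise -/

section Factorisation

variable {R : Type*} [CommSemiring R] {P : Type*} [Fintype P] [DecidableEq P]

/-- **Pinned sums of a product factorise**: `Σ_{X : X_p = x₀} ∏_i g_i(X_i) = g_p(x₀) · ∏_{j} Σ_y g_{p.succAbove j}(y)`.
[folklore] -/
private theorem sum_filter_prod_eq {m : ℕ} (p : Fin (m + 1)) (x₀ : P) (g : Fin (m + 1) → P → R) :
    ∑ X ∈ univ.filter (fun X : Fin (m + 1) → P => X p = x₀), ∏ i, g i (X i) =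
      g p x₀ * ∏ j : Fin m, ∑ y : P, g (p.succAbove j) y := by
  rw [sum_filter_apply_eq]
  simp_rw [Fin.prod_univ_succAbove _ p, Fin.insertNth_apply_same, Fin.insertNth_apply_succAbove]
  rw [← mul_sum, Fintype.prod_sum]

end Factorisation

/-! ### The sector transfer functions and the sectorised kernels of an image -/

section CrossGrid

variable (L M N : ℕ) [NeZero L]

/-- **The sector transfer function of a leg label** `ℓ = ((ω, σ), c)` between the dual-lattice point `x` and the grid leg `Y`:
`Φ_ℓ(x; Y) = Σ_k F_ω(k) e^{-i s_c k·x} S(((k,σ),c), Y)`, `S = hubbardGridSub L M β N` — the sector cutoff `F_ω`, multiplied into leg `ℓ`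
of a kernel and Fourier-transformed from the grid field at `Y` to the sector field at `x` (BGM's `F̃_{h,ω}(k(f))` per external line,
(2.70)–(2.71); zero unless `Y` has spin `σ` and charge `c`). [cite: BenfattoGiulianiMastropietro2006, §2.7 (2.70)–(2.71)] -/
def gridLegTransfer {Ns : ℕ} (β : ℝ) (Fam : Fin Ns → FreqMomentum L M → ℂ) (ℓ : SectorLeg Ns) (x : SpaceTimeIdx L M)
    (Y : GridLeg (GridPoint L N)) : ℂ :=
  ∑ k : FreqMomentum L M, Fam ℓ.1.1 k * hubbardPlaneWave L M β ℓ.2 k x * hubbardGridSub L M β N ((k, ℓ.1.2), ℓ.2) Y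

variable {L M N}

/-- **The sectorised kernels of the image of a grid polynomial**: for `G = map (toLin' S) F`,
`W_{m,Ω}(x) = Σ_{Y : Fin m → grid legs} [∏_i Φ_{Ω_i}(x_i; Y_i)] · kernel F m Y` (the kernels push forward by the tensor powers of `S`,
`kernel_map`, and the leg sums factorise). [cite: BenfattoGiulianiMastropietro2006, §2.7 (2.70)–(2.71)] -/
theorem sectorisedKernel_map_hubbardGridSub {Ns : ℕ} (β : ℝ) (Fam : Fin Ns → FreqMomentum L M → ℂ)
    (F : GrassmannAlgebra ℂ (GridLeg (GridPoint L N))) (m : ℕ) (Ω : Fin m → SectorLeg Ns) (x : Fin m → SpaceTimeIdx L M) :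
    sectorisedKernel L M β Fam (ExteriorAlgebra.map (Matrix.toLin' (hubbardGridSub L M β N)) F) m Ω x =
      ∑ Y : Fin m → GridLeg (GridPoint L N), (∏ i, gridLegTransfer L M N β Fam (Ω i) (x i) (Y i)) * kernel ℂ F m Y := by
  rw [sectorisedKernel_def]
  simp_rw [kernel_map, LinearMap.toMatrix'_toLin', mul_sum]
  rw [sum_comm]
  refine sum_congr rfl fun Y _ => ?_
  simp_rw [← mul_assoc]
  rw [← sum_mul]
  congr 1
  simp_rw [← prod_mul_distrib]
  simp only [gridLegTransfer]
  exact (Fintype.prod_sum (fun i (k : FreqMomentum L M) =>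
    Fam (Ω i).1.1 k * hubbardPlaneWave L M β (Ω i).2 k (x i) * hubbardGridSub L M β N ((k, (Ω i).1.2), (Ω i).2) (Y i))).symm

/-- The pointwise bound `|W_{m,Ω}(x)| ≤ Σ_Y [∏_i |Φ_{Ω_i}(x_i; Y_i)|] · |kernel F m Y|`. [cite: BenfattoGiulianiMastropietro2006, §2.7 (2.70)–(2.71)] -/
theorem norm_sectorisedKernel_map_hubbardGridSub_le {Ns : ℕ} (β : ℝ) (Fam : Fin Ns → FreqMomentum L M → ℂ)
    (F : GrassmannAlgebra ℂ (GridLeg (GridPoint L N))) (m : ℕ) (Ω : Fin m → SectorLeg Ns) (x : Fin m → SpaceTimeIdx L M) :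
    ‖sectorisedKernel L M β Fam (ExteriorAlgebra.map (Matrix.toLin' (hubbardGridSub L M β N)) F) m Ω x‖ ≤
      ∑ Y : Fin m → GridLeg (GridPoint L N), (∏ i, ‖gridLegTransfer L M N β Fam (Ω i) (x i) (Y i)‖) * ‖kernel ℂ F m Y‖ := by
  rw [sectorisedKernel_map_hubbardGridSub]
  refine (norm_sum_le _ _).trans (sum_le_sum fun Y _ => ?_)
  rw [norm_mul, norm_prod]

/-- **The leg-by-leg Young step**: for a fixed grid tuple `Y`, summing `ε^m ∏_i |Φ_{Ω_i}(x_i; Y_i)|` over the label tuples `Ω` with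
`Ω_p = s` and the position tuples `x` with `x_p = x₀` gives at most `|Φ_s(x₀; Y_p)| · B^m`, `B` bounding every label-summed weighted
`L¹` norm `Σ_ℓ ε Σ_x |Φ_ℓ(x; Y')|`. [cite: BenfattoGiulianiMastropietro2006, §2.8 (2.82)] -/
theorem sum_filter_sum_filter_prod_norm_le {S P Γ : Type*} [Fintype S] [DecidableEq S] [Fintype P] [DecidableEq P]
    {m : ℕ} {ε : ℝ} (hε : 0 ≤ ε) (Φ : S → P → Γ → ℂ) {B : ℝ} (hB : ∀ Y' : Γ, ∑ ℓ : S, ε * ∑ x : P, ‖Φ ℓ x Y'‖ ≤ B)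
    (p : Fin (m + 1)) (s : S) (x₀ : P) (Y : Fin (m + 1) → Γ) :
    ∑ Ω ∈ univ.filter (fun Ω : Fin (m + 1) → S => Ω p = s),
      ∑ x ∈ univ.filter (fun x : Fin (m + 1) → P => x p = x₀), ε ^ m * ∏ i, ‖Φ (Ω i) (x i) (Y i)‖ ≤
      ‖Φ s x₀ (Y p)‖ * B ^ m := by
  have h1 : ∀ Ω : Fin (m + 1) → S,
      ∑ x ∈ univ.filter (fun x : Fin (m + 1) → P => x p = x₀), ε ^ m * ∏ i, ‖Φ (Ω i) (x i) (Y i)‖ =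
        ‖Φ (Ω p) x₀ (Y p)‖ * ∏ j : Fin m, (ε * ∑ y : P, ‖Φ (Ω (p.succAbove j)) y (Y (p.succAbove j))‖) := by
    intro Ω
    rw [← mul_sum, sum_filter_prod_eq p x₀ (fun i y => ‖Φ (Ω i) y (Y i)‖), prod_mul_distrib, prod_const, card_univ,
      Fintype.card_fin]
    ring
  simp_rw [h1]
  rw [sum_filter_apply_eq]
  simp_rw [Fin.insertNth_apply_same, Fin.insertNth_apply_succAbove]
  have hps : (∑ Ω' : Fin m → S, ∏ j, ε * ∑ y : P, ‖Φ (Ω' j) y (Y (p.succAbove j))‖) =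
      ∏ j : Fin m, ∑ ℓ : S, ε * ∑ y : P, ‖Φ ℓ y (Y (p.succAbove j))‖ :=
    (Fintype.prod_sum (fun (j : Fin m) (ℓ : S) => ε * ∑ y : P, ‖Φ ℓ y (Y (p.succAbove j))‖)).symm
  rw [← mul_sum, hps]
  refine mul_le_mul_of_nonneg_left ?_ (norm_nonneg _)
  calc ∏ j : Fin m, ∑ ℓ : S, ε * ∑ y : P, ‖Φ ℓ y (Y (p.succAbove j))‖ ≤ ∏ _j : Fin m, B :=
        prod_le_prod (fun j _ => sum_nonneg fun ℓ _ => mul_nonneg hε (sum_nonneg fun _ _ => norm_nonneg _))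
          fun j _ => hB _
    _ = B ^ m := by rw [prod_const, card_univ, Fintype.card_fin]

/-- Bookkeeping: `Σ_Ω c·Σ_x Σ_Y a(Ω,x,Y) b(Y) = Σ_Y b(Y)·Σ_Ω Σ_x c·a(Ω,x,Y)`. [folklore] -/
private theorem sum_mul_sum_sum_rearrange {α γ δ : Type*} (sa : Finset α) (sb : Finset γ) [Fintype δ] (c : ℝ)
    (a : α → γ → δ → ℝ) (b : δ → ℝ) :
    ∑ Ω ∈ sa, c * ∑ x ∈ sb, ∑ Y, a Ω x Y * b Y = ∑ Y, b Y * ∑ Ω ∈ sa, ∑ x ∈ sb, c * a Ω x Y := by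
  simp_rw [mul_sum]
  rw [show (∑ Ω ∈ sa, ∑ x ∈ sb, ∑ Y, c * (a Ω x Y * b Y)) = ∑ Ω ∈ sa, ∑ Y, ∑ x ∈ sb, c * (a Ω x Y * b Y)
    from sum_congr rfl fun _ _ => sum_comm, sum_comm]
  exact sum_congr rfl fun Y _ => sum_congr rfl fun Ω _ => sum_congr rfl fun x _ => by ring

/-- **Cross-grid Young inequality.**  Let `F` be a polynomial of the grid algebra with pinned `ℓ¹` kernel norms
`Σ_{Y : Y p = w} ‖kernel F (m+1) Y‖ ≤ K` (every slot `p`, every grid leg `w`), and let the sector transfer functions of the multiplier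
family `Fam` satisfy `Σ_ℓ ε_x Σ_x |Φ_ℓ(x; Y)| ≤ B` (every grid leg `Y`; `ε_x = β/(2M)`) and `Σ_Y |Φ_ℓ(x; Y)| ≤ D` (every `ℓ`, `x`).  Then the
sectorised `L¹–L^∞` norm (BGM (2.76)) of the degree-`(m+1)` kernels of the image `map (toLin' S) F`, for ANY constraint set `A`, is
`≤ B^m · D · K`. [cite: BenfattoGiulianiMastropietro2006, §2.8 (2.82)] -/
theorem hubbardSectorKernelNorm_map_hubbardGridSub_le {Ns m : ℕ} {β : ℝ} (hβ : 0 ≤ β) (Fam : Fin Ns → FreqMomentum L M → ℂ)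
    (A : Finset (Fin (m + 1) → SectorLeg Ns)) (F : GrassmannAlgebra ℂ (GridLeg (GridPoint L N))) {B D K : ℝ}
    (hB0 : 0 ≤ B) (hD0 : 0 ≤ D) (hK0 : 0 ≤ K)
    (hB : ∀ Y : GridLeg (GridPoint L N),
      ∑ ℓ : SectorLeg Ns, imagTimeWeight β M * ∑ x : SpaceTimeIdx L M, ‖gridLegTransfer L M N β Fam ℓ x Y‖ ≤ B)
    (hD : ∀ (ℓ : SectorLeg Ns) (x : SpaceTimeIdx L M), ∑ Y : GridLeg (GridPoint L N), ‖gridLegTransfer L M N β Fam ℓ x Y‖ ≤ D)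
    (hK : ∀ (p : Fin (m + 1)) (w : GridLeg (GridPoint L N)),
      ∑ Y ∈ univ.filter (fun Y : Fin (m + 1) → GridLeg (GridPoint L N) => Y p = w), ‖kernel ℂ F (m + 1) Y‖ ≤ K) :
    hubbardSectorKernelNorm L M β Fam A (ExteriorAlgebra.map (Matrix.toLin' (hubbardGridSub L M β N)) F) ≤ B ^ m * D * K := by
  have hε : 0 ≤ imagTimeWeight β M := imagTimeWeight_nonneg hβ M
  rw [hubbardSectorKernelNorm_def]
  refine sectorisedKernelNorm_le_of_forall_le (by positivity) fun p s x₀ => ?_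
  refine (sectorLegSum_mono hε (subset_univ A) _ p s x₀).trans ?_
  rw [sectorLegSum_def]
  calc ∑ Ω ∈ univ.filter (fun Ω : Fin (m + 1) → SectorLeg Ns => Ω p = s), imagTimeWeight β M ^ m *
        ∑ x ∈ univ.filter (fun x : Fin (m + 1) → SpaceTimeIdx L M => x p = x₀),
          ‖sectorisedKernel L M β Fam (ExteriorAlgebra.map (Matrix.toLin' (hubbardGridSub L M β N)) F) (m + 1) Ω x‖
      ≤ ∑ Ω ∈ univ.filter (fun Ω : Fin (m + 1) → SectorLeg Ns => Ω p = s), imagTimeWeight β M ^ m *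
          ∑ x ∈ univ.filter (fun x : Fin (m + 1) → SpaceTimeIdx L M => x p = x₀),
            ∑ Y : Fin (m + 1) → GridLeg (GridPoint L N),
              (∏ i, ‖gridLegTransfer L M N β Fam (Ω i) (x i) (Y i)‖) * ‖kernel ℂ F (m + 1) Y‖ :=
        sum_le_sum fun Ω _ => mul_le_mul_of_nonneg_left
          (sum_le_sum fun x _ => norm_sectorisedKernel_map_hubbardGridSub_le β Fam F (m + 1) Ω x) (pow_nonneg hε m)
    _ = ∑ Y : Fin (m + 1) → GridLeg (GridPoint L N), ‖kernel ℂ F (m + 1) Y‖ *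
          ∑ Ω ∈ univ.filter (fun Ω : Fin (m + 1) → SectorLeg Ns => Ω p = s),
            ∑ x ∈ univ.filter (fun x : Fin (m + 1) → SpaceTimeIdx L M => x p = x₀),
              imagTimeWeight β M ^ m * ∏ i, ‖gridLegTransfer L M N β Fam (Ω i) (x i) (Y i)‖ :=
        sum_mul_sum_sum_rearrange _ _ _ _ _
    _ ≤ ∑ Y : Fin (m + 1) → GridLeg (GridPoint L N), ‖kernel ℂ F (m + 1) Y‖ *
          (‖gridLegTransfer L M N β Fam s x₀ (Y p)‖ * B ^ m) :=
        sum_le_sum fun Y _ => mul_le_mul_of_nonneg_left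
          (sum_filter_sum_filter_prod_norm_le hε (gridLegTransfer L M N β Fam) hB p s x₀ Y) (norm_nonneg _)
    _ = B ^ m * ∑ Y : Fin (m + 1) → GridLeg (GridPoint L N),
          ‖gridLegTransfer L M N β Fam s x₀ (Y p)‖ * ‖kernel ℂ F (m + 1) Y‖ := by
        rw [mul_sum]
        exact sum_congr rfl fun Y _ => by ring
    _ = B ^ m * ∑ w : GridLeg (GridPoint L N),
          ∑ Y ∈ univ.filter (fun Y : Fin (m + 1) → GridLeg (GridPoint L N) => Y p = w),
            ‖gridLegTransfer L M N β Fam s x₀ w‖ * ‖kernel ℂ F (m + 1) Y‖ := by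
        congr 1
        rw [← sum_fiberwise univ (fun Y : Fin (m + 1) → GridLeg (GridPoint L N) => Y p)
          (fun Y => ‖gridLegTransfer L M N β Fam s x₀ (Y p)‖ * ‖kernel ℂ F (m + 1) Y‖)]
        refine sum_congr rfl fun w _ => sum_congr rfl fun Y hY => ?_
        rw [(mem_filter.1 hY).2]
    _ = B ^ m * ∑ w : GridLeg (GridPoint L N), ‖gridLegTransfer L M N β Fam s x₀ w‖ *
          ∑ Y ∈ univ.filter (fun Y : Fin (m + 1) → GridLeg (GridPoint L N) => Y p = w), ‖kernel ℂ F (m + 1) Y‖ := by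
        simp_rw [mul_sum]
    _ ≤ B ^ m * ∑ w : GridLeg (GridPoint L N), ‖gridLegTransfer L M N β Fam s x₀ w‖ * K :=
        mul_le_mul_of_nonneg_left (sum_le_sum fun w _ => mul_le_mul_of_nonneg_left (hK p w) (norm_nonneg _)) (pow_nonneg hB0 m)
    _ = B ^ m * K * ∑ w : GridLeg (GridPoint L N), ‖gridLegTransfer L M N β Fam s x₀ w‖ := by
        rw [← sum_mul]
        ring
    _ ≤ B ^ m * K * D := mul_le_mul_of_nonneg_left (hD s x₀) (by positivity)
    _ = B ^ m * D * K := by ring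

end CrossGrid

end Literature.MathematicalPhysics.QuantumLattice

end
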